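import Literature.Barriers.AtomisticToContinuum.CohnElkiesNotSharp3DKernel
import Literature.Barriers.AtomisticToContinuum.CohnElkiesNotSharp3DCertificate

/-!
# The Cohn–Elkies bound is not sharp in `ℝ³` (Li 2022) — soundness of the kernel check

Fourth step towards discharging `Literature.Barriers.AtomisticToContinuum.Li2022_dualCertificate53`.
The kernel computation `CEKernel.compute` / `CEKernel.check` of `CohnElkiesNotSharp3DKernel.lean`
(specified there by `compute_spec` in terms of folded linear convolutions of the entry arrays) is
linked to the group `ℤ_N³ = Fin 3 → ZMod (2H+1)` and to the autoconvolution certificates of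
`CohnElkiesNotSharp3DCertificate.lean`:

* `betaT H TP TN : ℤ_N³ → ℤ`, the even integer function encoded by the tables (`betaT_neg`,
  `betaT_update_neg`);
* **key lemma** `sum_mul_sub_eq_cyc`: a `ℤ_N³`-sum `∑_z f(z) g(x - z)` of functions of the
  coordinates is the cyclic fold `cyc` of the linear convolution `conv3 f g` (the fibre of
  `z ↦ (coordinates of z, coordinates of x - z)` over `p₁ + p₂ ≡ x`), hence
  `(β ∗ β)(x) = cyc A (x) - cyc B (x)` (`autoconv_betaT`);
* `sum_eq_octant`: a sum over `ℤ_N³` of a function invariant under negating each coordinate is the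
  octant sum with multiplicities `wt` (as scanned);
* `corrMass_eq`, `posMass_eq`, `autoconv_betaT_zero`: the three quantities entering
  `certNu0`, `certTot` are the computed ones;
* `check_sound`: `check H s R TP TN Tn Td = true` implies the existence of a discrete dual
  certificate on `ℤ_{2H+1}³` with parameter `R` and dual bound `> Tn/Td`
  (`exists_dualCertificate_of_even`).

Elementary ([folklore]) throughout.
-/

open Finset
open scoped BigOperators

namespace Literature.Barriers.AtomisticToContinuum

namespace CEKernel

section Sound

variable (H : ℕ)

/-- Coordinates of a point of `ℤ_N³` as naturals in `[0, N)`. [folklore] -/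
def vof (x : Fin 3 → ZMod (2 * H + 1)) : ℕ × ℕ × ℕ := ((x 0).val, (x 1).val, (x 2).val)

/-- The point of `ℤ_N³` with given natural coordinates. [folklore] -/
def ofT (p : ℕ × ℕ × ℕ) : Fin 3 → ZMod (2 * H + 1) := ![(p.1 : ZMod (2 * H + 1)), p.2.1, p.2.2]

/-- Coordinates lie in the box. [folklore] -/
theorem vof_mem_box (x : Fin 3 → ZMod (2 * H + 1)) : vof H x ∈ box (2 * H + 1) := by
  rw [mem_box]
  simp only [vof]
  exact ⟨ZMod.val_lt _, ZMod.val_lt _, ZMod.val_lt _⟩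

/-- `ofT` inverts `vof`. [folklore] -/
theorem ofT_vof (x : Fin 3 → ZMod (2 * H + 1)) : ofT H (vof H x) = x := by
  funext i
  fin_cases i <;> simp [ofT, vof]

/-- `vof` inverts `ofT` on the box. [folklore] -/
theorem vof_ofT {p : ℕ × ℕ × ℕ} (hp : p ∈ box (2 * H + 1)) : vof H (ofT H p) = p := by
  rw [mem_box] at hp
  obtain ⟨a, b, c⟩ := p
  simp only [vof, ofT, Matrix.cons_val_zero, Matrix.cons_val_one, Matrix.cons_val]
  simp only at hp
  rw [ZMod.val_natCast_of_lt hp.1, ZMod.val_natCast_of_lt hp.2.1, ZMod.val_natCast_of_lt hp.2.2]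

/-- Sums over `ℤ_N³` as sums over the box of coordinates. [folklore] -/
theorem sum_eq_sum_box {M : Type*} [AddCommMonoid M] (F : (Fin 3 → ZMod (2 * H + 1)) → M) :
    ∑ x, F x = ∑ p ∈ box (2 * H + 1), F (ofT H p) := by
  refine Finset.sum_bij' (fun x _ ↦ vof H x) (fun p _ ↦ ofT H p) (fun x _ ↦ vof_mem_box H x)
    (fun p _ ↦ mem_univ _) (fun x _ ↦ ofT_vof H x) (fun p hp ↦ vof_ofT H hp) ?_
  intro x _
  rw [ofT_vof]

/-- `absBal` of the value is the absolute value of the balanced representative. [folklore] -/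
theorem absBal_val (z : ZMod (2 * H + 1)) : absBal H z.val = z.valMinAbs.natAbs := by
  rw [ZMod.valMinAbs_def_pos, absBal, show (2 * H + 1) / 2 = H by omega]
  have := ZMod.val_lt z
  split_ifs with h
  · exact (Int.natAbs_natCast _).symm
  · omega

variable (TP TN : ℕ)

/-- **The integer function `β` encoded by the tables**: `β⁺ - β⁻` where `β^± (x)` is the table entry
at the orbit key of `(|x₁|, |x₂|, |x₃|)`. [folklore] -/
def betaT (x : Fin 3 → ZMod (2 * H + 1)) : ℤ :=
  (cubeArr H TP (vof H x) : ℤ) - (cubeArr H TN (vof H x) : ℤ)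

/-- The entry array at the coordinates of a point reads the table at `(|x₁|, |x₂|, |x₃|)`. [folklore] -/
theorem cubeArr_vof (T : ℕ) (x : Fin 3 → ZMod (2 * H + 1)) : cubeArr H T (vof H x) =
    entry T (x 0).valMinAbs.natAbs (x 1).valMinAbs.natAbs (x 2).valMinAbs.natAbs := by
  simp only [cubeArr, cubeEntry, vof, absBal_val]

/-- `β` is invariant under negating any single coordinate. [folklore] -/
theorem betaT_update_neg (x : Fin 3 → ZMod (2 * H + 1)) (i : Fin 3) :
    betaT H TP TN (Function.update x i (-x i)) = betaT H TP TN x := by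
  unfold betaT
  rw [cubeArr_vof, cubeArr_vof, cubeArr_vof, cubeArr_vof]
  fin_cases i <;> simp [ZMod.natAbs_valMinAbs_neg]

/-- `β` is even. [folklore] -/
theorem betaT_neg (x : Fin 3 → ZMod (2 * H + 1)) : betaT H TP TN (-x) = betaT H TP TN x := by
  unfold betaT
  rw [cubeArr_vof, cubeArr_vof, cubeArr_vof, cubeArr_vof]
  simp [ZMod.natAbs_valMinAbs_neg]

/-! ### The cyclic autoconvolution as folded linear convolutions -/

/-- The coordinates of a difference. [folklore] -/
theorem val_sub_eq {N : ℕ} [NeZero N] (a b : ZMod N) :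
    (a - b).val = if b.val ≤ a.val then a.val - b.val else a.val + N - b.val := by
  have h := ZMod.val_add (a - b) b
  rw [sub_add_cancel] at h
  have hs := ZMod.val_lt (a - b)
  have hb := ZMod.val_lt b
  have ha := ZMod.val_lt a
  by_cases hlt : (a - b).val + b.val < N
  · rw [Nat.mod_eq_of_lt hlt] at h
    split_ifs <;> omega
  · rw [Nat.mod_eq_sub_mod (not_lt.mp hlt), Nat.mod_eq_of_lt (by omega)] at h
    split_ifs <;> omega

/-- One coordinate of the fibre equation `a + b = c + N e`, `a, b, c < N`, `e ∈ {0,1}`. [folklore] -/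
theorem coord_fiber {N a b c e : ℕ} (ha : a < N) (hb : b < N) (hc : c < N) (he : e < 2) :
    a + b = c + N * e ↔
      (e = (if a ≤ c then 0 else 1) ∧ b = (if a ≤ c then c - a else c + N - a)) := by
  by_cases hac : a ≤ c
  · rw [if_pos hac, if_pos hac]
    obtain ⟨d, rfl⟩ := Nat.exists_eq_add_of_le hac
    rw [Nat.add_sub_cancel_left]
    interval_cases e <;> omega
  · rw [if_neg hac, if_neg hac]
    obtain ⟨d, rfl⟩ := Nat.exists_eq_add_of_lt (not_le.mp hac)
    rw [show c + N - (c + d + 1) = N - (d + 1) by omega]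
    obtain ⟨M, rfl⟩ := Nat.exists_eq_add_of_lt ha
    rw [show c + d + 1 + M + 1 - (d + 1) = c + M + 1 by omega]
    interval_cases e <;> omega

variable {H}

/-- **Key lemma**: a `ℤ_N³`-sum of products `f(z) g(x - z)` of functions of the coordinates is
the cyclic fold of the linear convolution of `f` and `g`. [folklore] -/
theorem sum_mul_sub_eq_cyc (f g : ℕ × ℕ × ℕ → ℕ) (x : Fin 3 → ZMod (2 * H + 1)) :
    ∑ z, f (vof H z) * g (vof H (x - z)) = cyc (2 * H + 1) (conv3 (2 * H + 1) f g) (vof H x) := by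
  -- the unique partner of `p₁`
  set w : ℕ × ℕ × ℕ → ℕ × ℕ × ℕ := fun p ↦ vof H (x - ofT H p) with hw
  -- left side as a box sum
  have hL : ∑ z, f (vof H z) * g (vof H (x - z)) = ∑ p ∈ box (2 * H + 1), f p * g (w p) := by
    rw [sum_eq_sum_box]
    refine Finset.sum_congr rfl fun p hp ↦ ?_
    rw [vof_ofT H hp]
  rw [hL]
  -- right side
  unfold cyc conv3
  simp_rw [sum_filter, sum_product]
  -- ∑ e, ∑ p₁, ∑ p₂ (if ...) : bring `p₁` outside
  rw [sum_comm]
  refine Finset.sum_congr rfl fun p₁ hp₁ ↦ ?_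
  rw [sum_comm]
  -- for each `p₂` the sum over `e` of the indicator is the indicator of `p₂ = w p₁`
  have hx := vof_mem_box H x
  rw [mem_box] at hp₁ hx
  have hwval : w p₁ = (if p₁.1 ≤ (vof H x).1 then (vof H x).1 - p₁.1 else (vof H x).1 + (2 * H + 1) - p₁.1,
      if p₁.2.1 ≤ (vof H x).2.1 then (vof H x).2.1 - p₁.2.1 else (vof H x).2.1 + (2 * H + 1) - p₁.2.1,
      if p₁.2.2 ≤ (vof H x).2.2 then (vof H x).2.2 - p₁.2.2 else (vof H x).2.2 + (2 * H + 1) - p₁.2.2) := by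
    simp only [hw, vof, ofT, Pi.sub_apply, Matrix.cons_val_zero, Matrix.cons_val_one,
      Matrix.cons_val, val_sub_eq, ZMod.val_natCast_of_lt hp₁.1, ZMod.val_natCast_of_lt hp₁.2.1,
      ZMod.val_natCast_of_lt hp₁.2.2]
  have hwmem : w p₁ ∈ box (2 * H + 1) := vof_mem_box H _
  have hinner : ∀ p₂ ∈ box (2 * H + 1),
      (∑ e ∈ box 2, if p₁ + p₂ = ((vof H x).1 + (2 * H + 1) * e.1, (vof H x).2.1 + (2 * H + 1) * e.2.1,
          (vof H x).2.2 + (2 * H + 1) * e.2.2) then f p₁ * g p₂ else 0) =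
        if p₂ = w p₁ then f p₁ * g p₂ else 0 := by
    intro p₂ hp₂
    rw [mem_box] at hp₂
    obtain ⟨a₁, a₂, a₃⟩ := p₁
    obtain ⟨b₁, b₂, b₃⟩ := p₂
    simp only at hp₁ hp₂
    set e₀ : ℕ × ℕ × ℕ := (if a₁ ≤ (vof H x).1 then 0 else 1, if a₂ ≤ (vof H x).2.1 then 0 else 1,
      if a₃ ≤ (vof H x).2.2 then 0 else 1) with he₀
    have hcond : ∀ e ∈ box 2, ((a₁, a₂, a₃) + (b₁, b₂, b₃) = ((vof H x).1 + (2 * H + 1) * e.1,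
        (vof H x).2.1 + (2 * H + 1) * e.2.1, (vof H x).2.2 + (2 * H + 1) * e.2.2) ↔
        (e = e₀ ∧ (b₁, b₂, b₃) = w (a₁, a₂, a₃))) := by
      intro e he
      rw [mem_box] at he
      obtain ⟨e₁, e₂, e₃⟩ := e
      simp only at he
      rw [hwval, he₀]
      simp only [Prod.mk_add_mk, Prod.mk.injEq]
      rw [coord_fiber hp₁.1 hp₂.1 hx.1 he.1, coord_fiber hp₁.2.1 hp₂.2.1 hx.2.1 he.2.1,
        coord_fiber hp₁.2.2 hp₂.2.2 hx.2.2 he.2.2]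
      tauto
    rw [Finset.sum_congr rfl (fun e he ↦ if_congr (hcond e he) rfl rfl)]
    by_cases hb : (b₁, b₂, b₃) = w (a₁, a₂, a₃)
    · simp only [hb, and_true, if_true]
      rw [sum_ite_eq']
      rw [if_pos]
      rw [mem_box, he₀]
      refine ⟨?_, ?_, ?_⟩ <;> split_ifs <;> norm_num
    · simp [hb]
  rw [Finset.sum_congr rfl hinner, sum_ite_eq' (box (2 * H + 1)) (w p₁) (fun p₂ ↦ f p₁ * g p₂),
    if_pos hwmem]

/-- **The cyclic autoconvolution of `β` in terms of the computed digits**: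
`(β ∗ β)(x) = cyc A (x) - cyc B (x)`. [folklore] -/
theorem autoconv_betaT (x : Fin 3 → ZMod (2 * H + 1)) :
    autoconv (betaT H TP TN) x =
      (cyc (2 * H + 1) (arrA H TP TN) (vof H x) : ℤ) - (cyc (2 * H + 1) (arrB H TP TN) (vof H x) : ℤ) := by
  have hA : cyc (2 * H + 1) (arrA H TP TN) (vof H x) =
      cyc (2 * H + 1) (conv3 (2 * H + 1) (cubeArr H TP) (cubeArr H TP)) (vof H x) +
      cyc (2 * H + 1) (conv3 (2 * H + 1) (cubeArr H TN) (cubeArr H TN)) (vof H x) := by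
    simp only [cyc, arrA, sum_add_distrib]
  have hB : cyc (2 * H + 1) (arrB H TP TN) (vof H x) =
      cyc (2 * H + 1) (conv3 (2 * H + 1) (cubeArr H TP) (cubeArr H TN)) (vof H x) +
      cyc (2 * H + 1) (conv3 (2 * H + 1) (cubeArr H TN) (cubeArr H TP)) (vof H x) := by
    simp only [cyc, arrB, sum_add_distrib]
  rw [hA, hB, ← sum_mul_sub_eq_cyc, ← sum_mul_sub_eq_cyc, ← sum_mul_sub_eq_cyc,
    ← sum_mul_sub_eq_cyc]
  unfold autoconv betaT
  push_cast
  rw [← sum_add_distrib, ← sum_add_distrib, ← sum_sub_distrib]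
  refine Finset.sum_congr rfl fun z _ ↦ ?_
  ring

/-! ### The squared norm and the classes -/

/-- The squared norm of the balanced representative via `absBal` of the coordinates. [folklore] -/
theorem zmodSqNorm_eq (x : Fin 3 → ZMod (2 * H + 1)) : zmodSqNorm x =
    absBal H (vof H x).1 ^ 2 + absBal H (vof H x).2.1 ^ 2 + absBal H (vof H x).2.2 ^ 2 := by
  simp only [zmodSqNorm, Fin.sum_univ_three, vof, absBal_val]

/-- Only the origin has squared norm `0`. [folklore] -/
theorem zmodSqNorm_eq_zero_iff (x : Fin 3 → ZMod (2 * H + 1)) : zmodSqNorm x = 0 ↔ x = 0 := by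
  constructor
  · intro h
    simp only [zmodSqNorm, Fin.sum_univ_three] at h
    have h0 : ∀ i : Fin 3, (x i).valMinAbs.natAbs ^ 2 = 0 → x i = 0 := fun i hi ↦ by
      simpa [ZMod.valMinAbs_eq_zero] using hi
    funext i
    fin_cases i
    · exact h0 0 (by omega)
    · exact h0 1 (by omega)
    · exact h0 2 (by omega)
  · rintro rfl
    simp [zmodSqNorm]

/-- The class of a point computed from coordinates agrees with `x = 0` / shell / off-shell. [folklore] -/
theorem cls_vof (R : ℕ) (x : Fin 3 → ZMod (2 * H + 1)) :
    cls H R (vof H x).1 (vof H x).2.1 (vof H x).2.2 =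
      if x = 0 then 0 else if zmodSqNorm x < R then 1 else 2 := by
  unfold cls
  simp only
  rw [← zmodSqNorm_eq]
  by_cases hx : x = 0
  · subst hx
    simp [zmodSqNorm]
  · rw [if_neg hx, if_neg ((zmodSqNorm_eq_zero_iff x).not.mpr hx)]

/-! ### From octant sums to sums over `ℤ_N³` -/

/-- Invariance of a `ℤ_N³`-sum under negating one coordinate of the argument. [folklore] -/
theorem sum_update_neg {M : Type*} [AddCommMonoid M] (F : (Fin 3 → ZMod (2 * H + 1)) → M)
    (i : Fin 3) : ∑ x, F (Function.update x i (-x i)) = ∑ x, F x := by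
  refine Fintype.sum_equiv (Equiv.mk (fun x ↦ Function.update x i (-x i))
    (fun x ↦ Function.update x i (-x i)) ?_ ?_) _ _ (fun x ↦ rfl)
  all_goals
    intro x
    funext j
    by_cases hj : j = i
    · subst hj; simp
    · simp [Function.update_of_ne hj]

/-- The autoconvolution of a function invariant under an additive automorphism is invariant. [folklore] -/
theorem autoconv_comp_addEquiv {d m : ℕ} [NeZero m] (β : (Fin d → ZMod m) → ℤ)
    (σ : (Fin d → ZMod m) ≃+ (Fin d → ZMod m)) (hβ : ∀ x, β (σ x) = β x) (x : Fin d → ZMod m) :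
    autoconv β (σ x) = autoconv β x := by
  unfold autoconv
  rw [← Equiv.sum_comp σ.toEquiv]
  refine Finset.sum_congr rfl fun z _ ↦ ?_
  simp only [AddEquiv.toEquiv_eq_coe, AddEquiv.coe_toEquiv]
  rw [← map_sub, hβ, hβ]

/-- Negating coordinate `i` as an additive automorphism of `ℤ_N³`. [folklore] -/
def negAt {m : ℕ} (i : Fin 3) : (Fin 3 → ZMod m) ≃+ (Fin 3 → ZMod m) :=
  AddEquiv.piCongrRight fun j ↦ if j = i then AddEquiv.neg (ZMod m) else AddEquiv.refl (ZMod m)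

/-- `negAt i` negates coordinate `i`. [folklore] -/
theorem negAt_apply {m : ℕ} (i : Fin 3) (x : Fin 3 → ZMod m) :
    negAt i x = Function.update x i (-x i) := by
  funext j
  simp only [negAt, AddEquiv.piCongrRight_apply]
  by_cases hj : j = i
  · subst hj; simp
  · simp [hj]

/-- The autoconvolution of `β` is invariant under negating a coordinate. [folklore] -/
theorem autoconv_betaT_update_neg (x : Fin 3 → ZMod (2 * H + 1)) (i : Fin 3) :
    autoconv (betaT H TP TN) (Function.update x i (-x i)) = autoconv (betaT H TP TN) x := by
  rw [← negAt_apply]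
  exact autoconv_comp_addEquiv _ (negAt i) (fun y ↦ by rw [negAt_apply, betaT_update_neg]) x

/-! ### Octant sums with multiplicities -/

/-- Reflecting the third coordinate is negating it. [folklore] -/
theorem ofT_reflect₃ {t₁ t₂ t : ℕ} (ht : t ≤ 2 * H + 1) :
    ofT H (t₁, t₂, 2 * H + 1 - t) = Function.update (ofT H (t₁, t₂, t)) 2 (-(ofT H (t₁, t₂, t) 2)) := by
  funext j
  fin_cases j <;> simp [ofT, Nat.cast_sub ht]

/-- Reflecting the second coordinate is negating it. [folklore] -/
theorem ofT_reflect₂ {t₁ t t₃ : ℕ} (ht : t ≤ 2 * H + 1) :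
    ofT H (t₁, 2 * H + 1 - t, t₃) = Function.update (ofT H (t₁, t, t₃)) 1 (-(ofT H (t₁, t, t₃) 1)) := by
  funext j
  fin_cases j <;> simp [ofT, Nat.cast_sub ht]

/-- Reflecting the first coordinate is negating it. [folklore] -/
theorem ofT_reflect₁ {t t₂ t₃ : ℕ} (ht : t ≤ 2 * H + 1) :
    ofT H (2 * H + 1 - t, t₂, t₃) = Function.update (ofT H (t, t₂, t₃)) 0 (-(ofT H (t, t₂, t₃) 0)) := by
  funext j
  fin_cases j <;> simp [ofT, Nat.cast_sub ht]

/-- One-coordinate reduction to the half range with multiplicities. [folklore] -/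
theorem sum_range_wt (G : ℕ → ℤ) (hG : ∀ t, t ≤ 2 * H + 1 → H < t → G (2 * H + 1 - t) = G t) :
    ∑ t ∈ range (2 * H + 1), G t = ∑ a ∈ range (H + 1), (wt a : ℤ) * G a := by
  have h1 : ∑ t ∈ range (2 * H + 1), G t = ∑ t ∈ range (2 * H + 1), (fun _ t' ↦ G t') (absBal H t) t :=
    rfl
  rw [h1, sum_range_mirror H (fun _ t' ↦ G t')]
  refine Finset.sum_congr rfl fun a ha ↦ ?_
  rw [mem_range] at ha
  simp only [wt]
  split_ifs with h0
  · simp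
  · have := hG (2 * H + 1 - a) (by omega) (by omega)
    rw [show 2 * H + 1 - (2 * H + 1 - a) = a by omega] at this
    rw [← this]
    ring

/-- **Octant reduction**: a sum over `ℤ_N³` of a function invariant under negating each coordinate
is the weighted sum over the octant `[0, H]³`. [folklore] -/
theorem sum_eq_octant (F : (Fin 3 → ZMod (2 * H + 1)) → ℤ)
    (hF : ∀ x (i : Fin 3), F (Function.update x i (-x i)) = F x) :
    ∑ x, F x = ∑ t₃ ∈ range (H + 1), ∑ t₂ ∈ range (H + 1), ∑ t₁ ∈ range (H + 1),
      ((wt t₁ * wt t₂ * wt t₃ : ℕ) : ℤ) * F (ofT H (t₁, t₂, t₃)) := by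
  rw [sum_eq_sum_box, sum_box_eq]
  -- innermost coordinate `t₃`
  have h3 : ∀ t₁ t₂, ∑ t₃ ∈ range (2 * H + 1), F (ofT H (t₁, t₂, t₃)) =
      ∑ t₃ ∈ range (H + 1), (wt t₃ : ℤ) * F (ofT H (t₁, t₂, t₃)) := fun t₁ t₂ ↦
    sum_range_wt (fun t ↦ F (ofT H (t₁, t₂, t))) fun t ht _ ↦ by rw [ofT_reflect₃ ht, hF]
  have h2 : ∀ t₁, ∑ t₂ ∈ range (2 * H + 1), ∑ t₃ ∈ range (H + 1), (wt t₃ : ℤ) * F (ofT H (t₁, t₂, t₃)) =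
      ∑ t₂ ∈ range (H + 1), (wt t₂ : ℤ) *
        ∑ t₃ ∈ range (H + 1), (wt t₃ : ℤ) * F (ofT H (t₁, t₂, t₃)) := fun t₁ ↦
    sum_range_wt (fun t ↦ ∑ t₃ ∈ range (H + 1), (wt t₃ : ℤ) * F (ofT H (t₁, t, t₃))) fun t ht _ ↦
      Finset.sum_congr rfl fun t₃ _ ↦ by rw [ofT_reflect₂ ht, hF]
  have h1 : ∑ t₁ ∈ range (2 * H + 1), ∑ t₂ ∈ range (H + 1), (wt t₂ : ℤ) *
        ∑ t₃ ∈ range (H + 1), (wt t₃ : ℤ) * F (ofT H (t₁, t₂, t₃)) =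
      ∑ t₁ ∈ range (H + 1), (wt t₁ : ℤ) * ∑ t₂ ∈ range (H + 1), (wt t₂ : ℤ) *
        ∑ t₃ ∈ range (H + 1), (wt t₃ : ℤ) * F (ofT H (t₁, t₂, t₃)) :=
    sum_range_wt (fun t ↦ ∑ t₂ ∈ range (H + 1), (wt t₂ : ℤ) *
        ∑ t₃ ∈ range (H + 1), (wt t₃ : ℤ) * F (ofT H (t, t₂, t₃))) fun t ht _ ↦
      Finset.sum_congr rfl fun t₂ _ ↦ by
        congr 1
        exact Finset.sum_congr rfl fun t₃ _ ↦ by rw [ofT_reflect₁ ht, hF]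
  simp_rw [h3, h2]
  rw [h1]
  simp_rw [mul_sum]
  rw [← sum_comm3]
  refine Finset.sum_congr rfl fun t₃ _ ↦ Finset.sum_congr rfl fun t₂ _ ↦
    Finset.sum_congr rfl fun t₁ _ ↦ ?_
  push_cast
  ring

/-! ### The sums of the corrected certificate -/

/-- `corrC` is linear in the multiplicity. [folklore] -/
theorem corrC_mul (w a b cl : ℕ) : corrC w a b cl = w * corrC 1 a b cl := by
  unfold corrC; split_ifs <;> ring

/-- `posC` is linear in the multiplicity. [folklore] -/
theorem posC_mul (w a b cl : ℕ) : posC w a b cl = w * posC 1 a b cl := by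
  unfold posC; split_ifs <;> ring

/-- The correction summand at a point, as an integer. [folklore] -/
theorem corrC_one_eq (a b cl : ℕ) : (corrC 1 a b cl : ℤ) =
    if cl = 1 then |(a : ℤ) - b| else if cl = 2 then max (-((a : ℤ) - b)) 0 else 0 := by
  unfold corrC
  rw [abs_eq_max_neg]
  simp only [max_def]
  split_ifs <;> push_cast <;> omega

/-- The positive-part summand at a point, as an integer. [folklore] -/
theorem posC_one_eq (a b cl : ℕ) : (posC 1 a b cl : ℤ) =
    if cl = 2 then max ((a : ℤ) - b) 0 else 0 := by
  unfold posC
  simp only [max_def]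
  split_ifs <;> push_cast <;> omega

variable (R : ℕ)

/-- The squared norm is invariant under negating a coordinate. [folklore] -/
theorem zmodSqNorm_update_neg (x : Fin 3 → ZMod (2 * H + 1)) (i : Fin 3) :
    zmodSqNorm (Function.update x i (-x i)) = zmodSqNorm x := by
  simp only [zmodSqNorm, Fin.sum_univ_three]
  fin_cases i <;> simp [ZMod.natAbs_valMinAbs_neg]

/-- Negating a coordinate preserves being the origin. [folklore] -/
theorem update_neg_eq_zero_iff (x : Fin 3 → ZMod (2 * H + 1)) (i : Fin 3) :
    Function.update x i (-x i) = 0 ↔ x = 0 := by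
  rw [← zmodSqNorm_eq_zero_iff, zmodSqNorm_update_neg, zmodSqNorm_eq_zero_iff]

/-- **The correction mass is the computed one.** [folklore] -/
theorem corrMass_eq (s : ℕ) (hS : 8 * (sumSq H TP + sumSq H TN) < 2 ^ s) :
    corrMass R (betaT H TP TN) = ((compute H s R TP TN).corr : ℤ) := by
  rw [(compute_spec H s R TP TN hS).1, corrMass]
  push_cast
  rw [sum_eq_octant]
  · refine Finset.sum_congr rfl fun t₃ h₃ ↦ Finset.sum_congr rfl fun t₂ h₂ ↦
      Finset.sum_congr rfl fun t₁ h₁ ↦ ?_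
    rw [mem_range] at h₁ h₂ h₃
    have hmem : ((t₁, t₂, t₃) : ℕ × ℕ × ℕ) ∈ box (2 * H + 1) := by rw [mem_box]; simp only; omega
    have hcls := cls_vof R (ofT H (t₁, t₂, t₃))
    have hauto := autoconv_betaT (TP := TP) (TN := TN) (ofT H (t₁, t₂, t₃))
    rw [vof_ofT H hmem] at hcls hauto
    simp only at hcls
    rw [corrC_mul]
    push_cast
    rw [corrC_one_eq, hcls, hauto]
    congr 1
    by_cases hx : ofT H (t₁, t₂, t₃) = 0
    · simp [hx]
    · rw [if_neg hx, if_neg hx]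
      by_cases hsh : zmodSqNorm (ofT H (t₁, t₂, t₃)) < R
      · rw [if_pos hsh, if_pos hsh, if_pos rfl]
      · rw [if_neg hsh, if_neg hsh, if_neg (by decide), if_pos rfl]
  · intro x i
    simp only [update_neg_eq_zero_iff, zmodSqNorm_update_neg, autoconv_betaT_update_neg]

/-- **The positive mass is the computed one.** [folklore] -/
theorem posMass_eq (s : ℕ) (hS : 8 * (sumSq H TP + sumSq H TN) < 2 ^ s) :
    (∑ x, if x = 0 then 0 else if zmodSqNorm x < R then 0 else max (autoconv (betaT H TP TN) x) 0) =
      ((compute H s R TP TN).pos : ℤ) := by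
  rw [(compute_spec H s R TP TN hS).2.1]
  push_cast
  rw [sum_eq_octant]
  · refine Finset.sum_congr rfl fun t₃ h₃ ↦ Finset.sum_congr rfl fun t₂ h₂ ↦
      Finset.sum_congr rfl fun t₁ h₁ ↦ ?_
    rw [mem_range] at h₁ h₂ h₃
    have hmem : ((t₁, t₂, t₃) : ℕ × ℕ × ℕ) ∈ box (2 * H + 1) := by rw [mem_box]; simp only; omega
    have hcls := cls_vof R (ofT H (t₁, t₂, t₃))
    have hauto := autoconv_betaT (TP := TP) (TN := TN) (ofT H (t₁, t₂, t₃))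
    rw [vof_ofT H hmem] at hcls hauto
    simp only at hcls
    rw [posC_mul]
    push_cast
    rw [posC_one_eq, hcls, hauto]
    congr 1
    by_cases hx : ofT H (t₁, t₂, t₃) = 0
    · simp [hx]
    · rw [if_neg hx, if_neg hx]
      by_cases hsh : zmodSqNorm (ofT H (t₁, t₂, t₃)) < R
      · rw [if_pos hsh, if_pos hsh, if_neg (by decide)]
      · rw [if_neg hsh, if_neg hsh, if_pos rfl]
  · intro x i
    simp only [update_neg_eq_zero_iff, zmodSqNorm_update_neg, autoconv_betaT_update_neg]

/-- The autoconvolution of `β` at the origin is the computed `A(0) - B(0)`. [folklore] -/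
theorem autoconv_betaT_zero (s : ℕ) (hS : 8 * (sumSq H TP + sumSq H TN) < 2 ^ s) :
    autoconv (betaT H TP TN) 0 = ((compute H s R TP TN).a0 : ℤ) - (compute H s R TP TN).b0 := by
  rw [(compute_spec H s R TP TN hS).2.2.1, (compute_spec H s R TP TN hS).2.2.2.1, autoconv_betaT]
  have : vof H (0 : Fin 3 → ZMod (2 * H + 1)) = (0, 0, 0) := by simp [vof]
  rw [this]

/-- **Soundness of the kernel check**: if `check` evaluates to `true` then the even integer function
`β` encoded by the tables yields a discrete dual certificate on `ℤ_{2H+1}³` with parameter `R`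
whose dual bound exceeds `Tn/Td`. [folklore] -/
theorem check_sound {H s R TP TN Tn Td : ℕ} (h : check H s R TP TN Tn Td = true) :
    ∃ ν : (Fin 3 → ZMod (2 * H + 1)) → ℝ, IsDiscreteDualCertificate R ν ∧
      (Tn / Td : ℝ) < discreteDualBound R ν := by
  unfold check at h
  simp only [decide_eq_true_eq] at h
  obtain ⟨hssq, hab, hTd, hineq⟩ := h
  have hS : 8 * (sumSq H TP + sumSq H TN) < 2 ^ s := hssq
  refine exists_dualCertificate_of_even R (betaT H TP TN) (betaT_neg H TP TN)
    (NU0 := (compute H s R TP TN).a0 - (compute H s R TP TN).b0 + (compute H s R TP TN).corr)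
    (TOT := (compute H s R TP TN).a0 - (compute H s R TP TN).b0 + (compute H s R TP TN).corr +
      (compute H s R TP TN).pos) (Tn := Tn) (Td := Td) ?_ ?_ (by omega) hTd hineq
  · unfold certNu0
    rw [corrMass_eq TP TN R s hS, autoconv_betaT_zero TP TN R s hS]
    push_cast [Nat.cast_sub hab.le]
    ring
  · unfold certTot certNu0
    rw [corrMass_eq TP TN R s hS, autoconv_betaT_zero TP TN R s hS, posMass_eq TP TN R s hS]
    push_cast [Nat.cast_sub hab.le]
    ring

end Sound

end CEKernel

end Literature.Barriers.AtomisticToContinuum
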